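import Summits.BirchSwinnertonDyer.BirchSwinnertonDyer.Theorems.ResidualThetaTransportAtTwoSignedMuSeedAtTwoPlusJetLevelWallThird
import Summits.BirchSwinnertonDyer.BirchSwinnertonDyer.Theorems.ResidualThetaTransportAtTwoSignedMuSeedAtTwoPlusJetLevelStepDelta
import Summits.BirchSwinnertonDyer.BirchSwinnertonDyer.Theorems.ResidualThetaTransportAtTwoSignedMuSeedAtTwoPlusJetFormalGroupLawDegFour
import Summits.BirchSwinnertonDyer.BirchSwinnertonDyer.Theorems.ResidualThetaTransportAtTwoSignedMuSeedAtTwoPlusJetLevelTwoWall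
import HarnessLib

/-!
# The LEVEL-TWO WALL, complete below the threshold `62`, and the refined shape `δ = ū t^N + c t^{2N} + O(t^{2N+2})` of the tree's level step
# (seed line `jet-character-sums`, J4/J5; crux `SignedMuSeedAtTwoPlus` stmt-BirchSwinnertonDyer-21438; Kμ⁺ stmt-BirchSwinnertonDyer-20689)

Cell `bsd-wall`, width seat `bsd-wall-rtt-p4-w2` g13 (`--supports`, closes nothing).  THEOREMS ONLY; the lines are NOT registered (W-79); BSD is not
proved by this.

* **`exists_levelStep_delta_shape₃`** — on the tilt curve `Ẽ = (y² + y = x³)` in characteristic `2`, for `z ∈ t·k⟦t⟧` and `n ≥ 1` (`N = 2^n`):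
  `F̄(z^N, t) − t = C(z₁^N)·t^N + C(z₂^N)·t^{2N} + t^{2N+2}·ε'` — from `F̄ = z₀ + z₁ + z₀²z₁²·H` (`X_zero_sq_mul_X_one_sq_dvd_formalGroupLaw_sub`,
  p676719) and Frobenius; this is the `δ`-hypothesis of `coeff_levelStep_belowThreshold` (p679704) with `ū = z₁^N`, `c = z₂^N`.
* **`levelTwo_wall_complete`** — `N = 16`, `ord S₁ ≥ 14`, `S₁' = S₁²`, `δ₁ = ū₁t¹⁶ + c₁t³² + t³⁴ε'`:
  `[t⁵⁹]S₂ = 0`, **`[t⁶⁰]S₂ = ū₁U₂₂² + ū₁²U₃₀ + c₁U₁₄²`**, `[t⁶¹]S₂ = 0` — together with `levelTwo_wall` (p679160: `[t⁴⁴], [t⁴⁸], [t⁵²], [t⁵⁶]`)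
  every coefficient of `S₂` below the `NonDeg(2)` threshold `4³ − 2 = 62` that can be non-zero is one of
  `[t⁴⁴] = ū₁U₁₄² + ū₁²U₁₄`, `[t⁴⁸] = ū₁U₁₆² + ū₁²U₁₈`, `[t⁵²] = ū₁U₁₈² + ū₁²U₂₂`, `[t⁵⁶] = ū₁U₂₀² + ū₁²U₂₆`, `[t⁶⁰] = ū₁U₂₂² + ū₁²U₃₀ + c₁U₁₄²`
  (the remaining `e < 62` vanish by `coeff_levelStep_eq_zero_of_lt` / `levelTwo_wall_odd` / the square law; not re-listed here).

References: the card (J4, J5 «deep wall»); [SilvermanAEC2009] IV.1 for context only.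
-/

set_option autoImplicit false
-- the Theorems namespace of this sub repeats the summit name by design (D-0017 nested layout)
set_option linter.dupNamespace false

noncomputable section

open PowerSeries Finset

namespace Summit.BirchSwinnertonDyer.BirchSwinnertonDyer.Theorems.SignedMuAtTwo.JetCharacterSums

variable {k : Type*} [CommRing k] [CharP k 2]

/-- `z(0) = 0 ⟹ z^{2^n} = C(z₁^{2^n})·t^{2^n} + C(z₂^{2^n})·t^{2·2^n} + t^{3·2^n}·ρ` in characteristic `2`. [folklore] -/
theorem pow_two_pow_eq_of_constantCoeff_eq_zero₃ {z : k⟦X⟧} (hz : constantCoeff z = 0) (n : ℕ) :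
    ∃ ρ : k⟦X⟧, z ^ 2 ^ n = C (coeff 1 z ^ 2 ^ n) * X ^ 2 ^ n + C (coeff 2 z ^ 2 ^ n) * X ^ (2 * 2 ^ n) + X ^ (3 * 2 ^ n) * ρ := by
  obtain ⟨z', hz'⟩ : (X : k⟦X⟧) ^ 3 ∣ z - C (coeff 1 z) * X - C (coeff 2 z) * X ^ 2 := by
    refine X_pow_dvd_iff.mpr fun m hm => ?_
    interval_cases m
    · simp [coeff_zero_eq_constantCoeff, hz]
    · simp [coeff_X_pow, coeff_C_mul]
    · simp [coeff_X_pow, coeff_C_mul]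
  refine ⟨z' ^ 2 ^ n, ?_⟩
  have hz3 : z = C (coeff 1 z) * X + C (coeff 2 z) * X ^ 2 + X ^ 3 * z' := by linear_combination hz'
  calc z ^ 2 ^ n = (C (coeff 1 z) * X + C (coeff 2 z) * X ^ 2 + X ^ 3 * z') ^ 2 ^ n := by rw [← hz3]
    _ = C (coeff 1 z ^ 2 ^ n) * X ^ 2 ^ n + C (coeff 2 z ^ 2 ^ n) * X ^ (2 * 2 ^ n) + X ^ (3 * 2 ^ n) * z' ^ 2 ^ n := by
        rw [add_pow_two_pow_charTwo, add_pow_two_pow_charTwo, mul_pow, mul_pow, mul_pow, map_pow, map_pow, ← pow_mul,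
          ← pow_mul]

/-- **The refined shape of the level step**: on `Ẽ = (y² + y = x³)` in characteristic `2`, for `z ∈ t·k⟦t⟧` and `n ≥ 1`,
`F̄(z^{2^n}, t) − t = C(z₁^{2^n})·t^{2^n} + C(z₂^{2^n})·t^{2·2^n} + t^{2·2^n + 2}·ε'` (`F̄ = z₀ + z₁ + z₀²z₁²H`). [folklore] -/
theorem exists_levelStep_delta_shape₃ {z : k⟦X⟧} (hz : constantCoeff z = 0) {n : ℕ} (hn : 1 ≤ n) :
    ∃ ε : k⟦X⟧, MvPowerSeries.subst ![z ^ 2 ^ n, (X : k⟦X⟧)] (⟨0, 0, 1, 0, 0⟩ : WeierstrassCurve k).formalGroupLaw - X =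
      C (coeff 1 z ^ 2 ^ n) * X ^ 2 ^ n + C (coeff 2 z ^ 2 ^ n) * X ^ (2 * 2 ^ n) + X ^ (2 * 2 ^ n + 2) * ε := by
  obtain ⟨ρ, hρ⟩ := pow_two_pow_eq_of_constantCoeff_eq_zero₃ hz n
  -- `N = 2^n = m + 2`
  obtain ⟨m, hm⟩ : ∃ m, 2 ^ n = m + 2 := ⟨2 ^ n - 2, by
    have : 2 ≤ 2 ^ n := by
      calc (2 : ℕ) = 2 ^ 1 := by norm_num
        _ ≤ 2 ^ n := Nat.pow_le_pow_right (by norm_num) hn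
    omega⟩
  rw [hm] at hρ ⊢
  set y : k⟦X⟧ := z ^ (m + 2) with hydef
  have hy : constantCoeff y = 0 := by rw [hydef, map_pow, hz, zero_pow (by omega)]
  have hs : MvPowerSeries.HasSubst ![y, (X : k⟦X⟧)] := Tilt.hasSubst_pair_X hy
  obtain ⟨H, hH⟩ := X_zero_sq_mul_X_one_sq_dvd_formalGroupLaw_sub k
  have hF : (⟨0, 0, 1, 0, 0⟩ : WeierstrassCurve k).formalGroupLaw =
      MvPowerSeries.X 0 + MvPowerSeries.X 1 + MvPowerSeries.X 0 ^ 2 * MvPowerSeries.X 1 ^ 2 * H := by rw [← hH]; ring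
  have hsub : MvPowerSeries.subst ![y, (X : k⟦X⟧)] (⟨0, 0, 1, 0, 0⟩ : WeierstrassCurve k).formalGroupLaw =
      y + X + y ^ 2 * X ^ 2 * MvPowerSeries.subst ![y, (X : k⟦X⟧)] H := by
    conv_lhs => rw [hF]
    rw [← MvPowerSeries.coe_substAlgHom hs]
    simp only [map_add, map_mul, map_pow, MvPowerSeries.substAlgHom_X]
    rfl
  refine ⟨X ^ m * ρ + (C (coeff 1 z ^ (m + 2)) + C (coeff 2 z ^ (m + 2)) * X ^ (m + 2) + X ^ (m + 2) * X ^ 2 * X ^ m * ρ) ^ 2 *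
    MvPowerSeries.subst ![y, (X : k⟦X⟧)] H, ?_⟩
  rw [hsub]
  linear_combination (1 + X ^ 2 * MvPowerSeries.subst ![y, (X : k⟦X⟧)] H *
    (y + (C (coeff 1 z ^ (m + 2)) * X ^ (m + 2) + C (coeff 2 z ^ (m + 2)) * X ^ (2 * (m + 2)) + X ^ (3 * (m + 2)) * ρ))) * hρ

section LevelTwo

variable {S δ ε : PowerSeries k} {u c : k}

/-- **The level-two wall, completed below the threshold `62`**: `S₁' = S₁²`, `ord S₁ ≥ 14`, `δ₁ = ū₁t¹⁶ + c₁t³² + t³⁴ε'` ⟹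
`[t⁵⁹]S₂ = 0`, `[t⁶⁰]S₂ = ū₁U₂₂² + ū₁²U₃₀ + c₁U₁₄²`, `[t⁶¹]S₂ = 0` (`C(30,2) = 435`, `C(15,3) = 455`, `C(31,2) = 465` odd; `C(29,2)`, `C(14,3)`,
`C(16,3)` even; `U₁₅ = U₇² = 0`, `U₃₁ = U₁₅² = 0`). [folklore] -/
theorem levelTwo_wall_complete (hR : d⁄dX k S = S * S) (hv : ((14 : ℕ) : ℕ∞) ≤ S.order)
    (hδ : δ = C u * X ^ 16 + C c * X ^ (2 * 16) + X ^ (2 * 16 + 2) * ε) :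
    coeff 59 (S + S.subst (X + δ)) = 0 ∧
      coeff 60 (S + S.subst (X + δ)) = u * coeff 22 S ^ 2 + u ^ 2 * coeff 30 S + c * coeff 14 S ^ 2 ∧
      coeff 61 (S + S.subst (X + δ)) = 0 := by
  have hN : 1 ≤ 16 := by norm_num
  have h7 : coeff 7 S = 0 := coeff_of_lt_order 7 (lt_of_lt_of_le (by exact_mod_cast (by norm_num)) hv)
  have h15 : coeff 15 S = 0 := by rw [show 15 = 2 * 7 + 1 from rfl, coeff_odd_of_riccati hR, h7]; ring
  have h31 : coeff 31 S = 0 := by rw [show 31 = 2 * 15 + 1 from rfl, coeff_odd_of_riccati hR, h15]; ring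
  refine ⟨?_, ?_, ?_⟩
  · rw [coeff_levelStep_belowThreshold hN hR hv (by norm_num) (by norm_num) hδ (by norm_num) (by norm_num),
      show 59 - 16 = 2 * 21 + 1 from rfl, coeff_mul_self_of_odd, show 59 - 2 * 16 = 2 * 13 + 1 from rfl, coeff_mul_self_of_odd,
      show 2 * 13 + 1 + 2 = 29 from rfl, show 59 + 3 - 3 * 16 = 14 from rfl,
      show Nat.choose 29 2 = 2 * 203 from by norm_num [Nat.choose_two_right],
      show Nat.choose 14 3 = 2 * 182 from by decide]
    have h2k : (2 : k) = 0 := CharTwo.two_eq_zero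
    push_cast
    linear_combination (u ^ 2 * 203 * coeff 29 S + u ^ 3 * 182 * coeff 14 S) * h2k
  · rw [coeff_levelStep_belowThreshold hN hR hv (by norm_num) (by norm_num) hδ (by norm_num) (by norm_num),
      show 60 - 16 = 2 * 22 from rfl, coeff_mul_self_two_mul, show 60 - 2 * 16 = 2 * 14 from rfl, coeff_mul_self_two_mul,
      show 2 * 14 + 2 = 30 from rfl, show 60 + 3 - 3 * 16 = 15 from rfl, h15,
      natCast_eq_one_of_odd ⟨217, by norm_num [Nat.choose_two_right]⟩]
    ring
  · rw [coeff_levelStep_belowThreshold hN hR hv (by norm_num) (by norm_num) hδ (by norm_num) (by norm_num),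
      show 61 - 16 = 2 * 22 + 1 from rfl, coeff_mul_self_of_odd, show 61 - 2 * 16 = 2 * 14 + 1 from rfl, coeff_mul_self_of_odd,
      show 2 * 14 + 1 + 2 = 31 from rfl, h31, show 61 + 3 - 3 * 16 = 16 from rfl,
      show Nat.choose 16 3 = 2 * 280 from by decide]
    have h2k : (2 : k) = 0 := CharTwo.two_eq_zero
    push_cast
    linear_combination (u ^ 3 * 280 * coeff 16 S) * h2k

end LevelTwo

end Summit.BirchSwinnertonDyer.BirchSwinnertonDyer.Theorems.SignedMuAtTwo.JetCharacterSums

end
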